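import Mathlib
import Summits.ResolutionOfSingularities.ResolutionOfSingularities.Theorems.WeightedInvariantLocalWeightedDropNCResSurfGraphCurveApex
import Summits.ResolutionOfSingularities.ResolutionOfSingularities.Theorems.WeightedInvariantLocalWeightedDropNCResSurfGraphRegime

/-!
# `WeightedInvariant.LocalWeightedDrop`: NC-resolution settings for the TOT₂ line — GRAPH SURFACES, part 19: DEFINITIONS FOR THE LOOP `SurfLoop`
# (loop states carrying their graph datum, the plane SHADOW, the successor data of the point and curve moves, base re-coordinatisations)

Crux item stmt-ResolutionOfSingularities-8899 `LocalWeightedDrop` (route `ResolutionOfSingularities/WeightedInvariant`), ENGINE skeleton v34/v35, residual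
`stub_wildWideApexFourStartsWon` — res-L1-w43-strat-1's line `directrix-cut` v3f, piece PL₃, sub-skeleton `pl3_split_v1` (7519a9009475ab47) stub
`stub_apexPlaneSurfaceThree` = THE SURFACE SUB-CASE `ApexPlaneSurfaceExit` (…NCResSurfGraphRegime), reduced there to the loop obligation `SurfLoop k m`.
Design memo `L/res-L1-w43-stub-4/g6/SURFLOOP-DESIGN.md`.  [OURS · L1 W4.3 · chain w43 · seat res-L1-w43-stub-4 gen 6; DEFINITIONS ONLY (bookkeeping of the
loop: no new mathematics); the count game is the programme's own; nothing here is a statement of any manuscript; AI-produced, gate-checked, weaker than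
expert review.]

THE LOOP (memo §0–§4).  A loop state is an admissibly decorated position `(b₀, δ)` together with a permissible graph surface `(a, b, ψ)` for the product
`g = f·∏_O x_l` and apex dimension `≤ 2` (`SurfState`).  Its PLANE SHADOW is the plane germ `x₀^{[a ∈ E]} · x₁^{[b ∈ E]} · ∏ ψ_l ∈ k⟦x₀,x₁⟧` (product over
the boundary letters off the base with non-zero trace): the total boundary divisor restricted to the surface, read in the base parameters.  While the
shadow is NOT a normal crossing the loop blows up points and the count of non-normal-crossing infinitely near points of the shadow
(`Literature…PlaneGermNonNCCountRad`, a theorem of the tree) drops; once it is a normal crossing, one re-coordinatisation of the base plane makes every trace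
a monomial times a unit, and the monomial endgame (curve moves along the base axes, point moves) terminates by a no-infinite-play argument.

* `Decoration.ApexLE2 δ` — apex dimension `≤ 2` of the product: every three invariance vectors of `in_c g` are dependent (the verbatim `htwo` binder of
  parts 1–18);
* `SurfDatum k m` — `(b₀, δ, a, b, ψ)`; `SurfDatum.Valid` — admissible + permissible graph surface + `ApexLE2`; `SurfDatum.toState` — the pair `(b₀, δ)`;
* `SurfDatum.off` — the boundary letters off the base; `SurfDatum.shadow` — the plane shadow;
* `SurfDatum.swap` — the same state read with the base letters exchanged (…SurfGraphSwap);
* `SurfDatum.pointSucc σ c G` — the successor datum of the identity POINT move at the answer `c` read at the slot `a` (successor germ `s·G|_{y_a=0}`;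
  new base `(0, b⁺)`: THE EXCEPTIONAL LETTER FIRST; traces `ψ'(x₀,x₁) = (ψ(λx₀, x₀(μ+x₁)) − c_l x₀)/x₀`, `(λ, μ) = (c_a, c_b)` — the swapped `step₂` of part 6);
  reading at the slot `b` is `σ.swap.pointSucc`;
* `SurfDatum.curveSucc σ c G` — the successor datum of the CURVE move along `S ∩ {x_a = 0}` (part 11's `curveStep`, swapped: exceptional letter first,
  traces `ψ(λx₀, x₁)/x₀ − c_l`); the curve move along `S ∩ {x_b = 0}` is `σ.swap.curveSucc`;
* `baseChange a b Θ` — the substitution re-coordinatising the base plane by a two-variable legal `Θ` (`x_a ↦ Θ₀(x_a,x_b)`, `x_b ↦ Θ₁(x_a,x_b)`, other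
  letters fixed) and `SurfDatum.twist σ Θ` — the re-coordinatised state (germ `b₀∘R_Θ`, equation `f∘R_Θ`, same letters, traces `ψ_l∘Θ`);
* `SurfDatum.IsMonomial σ e` — every off-base boundary trace is `0` or a unit times `x₀^{(e l).1} x₁^{(e l).2}`; `SurfDatum.expMultiset σ e` — the multiset
  of exponent pairs of the non-zero off-base boundary traces (the endgame's measure carrier).
-/

set_option linter.dupNamespace false -- mandated namespace of this single-conjunct summit

noncomputable section

namespace Summit.ResolutionOfSingularities.ResolutionOfSingularities.Theorems

namespace TameFourTupleDrop

open MvPowerSeries Literature.AlgebraicGeometry.Resolution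

variable {k : Type} [Field k] {m : ℕ}

/-- APEX DIMENSION `≤ 2` OF THE PRODUCT `g = f·∏_O x_l`: every three invariance vectors of its degree-`c` form are linearly dependent (the verbatim
`htwo` binder of the graph-surface files). [OURS] -/
def Decoration.ApexLE2 (δ : Decoration k m) : Prop :=
  ∀ u₁ u₂ u₃ : Fin (m + 1) → k,
    (∀ v, CobordantChart.initEval (fun _ : Fin (m + 1) => 1) (v + u₁) δ.c (δ.f * ∏ l ∈ δ.O, X l) =
      CobordantChart.initEval (fun _ : Fin (m + 1) => 1) v δ.c (δ.f * ∏ l ∈ δ.O, X l)) →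
    (∀ v, CobordantChart.initEval (fun _ : Fin (m + 1) => 1) (v + u₂) δ.c (δ.f * ∏ l ∈ δ.O, X l) =
      CobordantChart.initEval (fun _ : Fin (m + 1) => 1) v δ.c (δ.f * ∏ l ∈ δ.O, X l)) →
    (∀ v, CobordantChart.initEval (fun _ : Fin (m + 1) => 1) (v + u₃) δ.c (δ.f * ∏ l ∈ δ.O, X l) =
      CobordantChart.initEval (fun _ : Fin (m + 1) => 1) v δ.c (δ.f * ∏ l ∈ δ.O, X l)) →
    ∃ α β γ : k, (α ≠ 0 ∨ β ≠ 0 ∨ γ ≠ 0) ∧ α • u₁ + β • u₂ + γ • u₃ = 0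

/-- Unfolding of `ApexLE2`. -/
theorem Decoration.apexLE2_iff (δ : Decoration k m) : δ.ApexLE2 ↔
    ∀ u₁ u₂ u₃ : Fin (m + 1) → k,
      (∀ v, CobordantChart.initEval (fun _ : Fin (m + 1) => 1) (v + u₁) δ.c (δ.f * ∏ l ∈ δ.O, X l) =
        CobordantChart.initEval (fun _ : Fin (m + 1) => 1) v δ.c (δ.f * ∏ l ∈ δ.O, X l)) →
      (∀ v, CobordantChart.initEval (fun _ : Fin (m + 1) => 1) (v + u₂) δ.c (δ.f * ∏ l ∈ δ.O, X l) =
        CobordantChart.initEval (fun _ : Fin (m + 1) => 1) v δ.c (δ.f * ∏ l ∈ δ.O, X l)) →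
      (∀ v, CobordantChart.initEval (fun _ : Fin (m + 1) => 1) (v + u₃) δ.c (δ.f * ∏ l ∈ δ.O, X l) =
        CobordantChart.initEval (fun _ : Fin (m + 1) => 1) v δ.c (δ.f * ∏ l ∈ δ.O, X l)) →
      ∃ α β γ : k, (α ≠ 0 ∨ β ≠ 0 ∨ γ ≠ 0) ∧ α • u₁ + β • u₂ + γ • u₃ = 0 := Iff.rfl

namespace GraphSurf

/-- `SurfState` is «some permissible graph surface, and `ApexLE2`». -/
theorem surfState_iff (δ : Decoration k m) : SurfState δ ↔
    (∃ (a b : Fin (m + 1)) (ψ : Fin (m + 1) → MvPowerSeries (Fin 2) k), a ≠ b ∧ (∀ j, ¬ (j = a ∨ j = b) → constantCoeff (ψ j) = 0) ∧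
      InOffPlaneIdeal a b δ.c (subst (shear a b ψ) (δ.f * ∏ l ∈ δ.O, X l))) ∧ δ.ApexLE2 := Iff.rfl

variable (k m) in
/-- A LOOP STATE of S-E2-SURF: a position `b₀`, a decoration `δ`, and a graph datum — base letters `a, b` and the two-variable series `ψ` (the traces
`ψ_l(x_a, x_b)` of the letters off the base). [OURS] -/
structure SurfDatum where
  /-- the position (germ) -/
  b₀ : MvPowerSeries (Fin (m + 1)) k
  /-- its decoration -/
  δ : Decoration k m
  /-- first base letter (its trace parameter is `x₀` of `k⟦x₀,x₁⟧`) -/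
  a : Fin (m + 1)
  /-- second base letter (trace parameter `x₁`) -/
  b : Fin (m + 1)
  /-- the graph datum: `S = {x_j = ψ_j(x_a, x_b) : j ∉ {a,b}}` -/
  ψ : Fin (m + 1) → MvPowerSeries (Fin 2) k

namespace SurfDatum

/-- The underlying decorated state `(b₀, δ)`. -/
def toState (σ : SurfDatum k m) : MvPowerSeries (Fin (m + 1)) k × Decoration k m := (σ.b₀, σ.δ)

/-- VALIDITY of a loop state: admissibly decorated, `a ≠ b`, traces vanish at the origin off the base, the graph surface is permissible at order `c`
for the product, and apex dimension `≤ 2`. [OURS] -/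
def Valid (σ : SurfDatum k m) : Prop :=
  Admissible σ.b₀ σ.δ ∧ σ.a ≠ σ.b ∧ (∀ j, ¬ (j = σ.a ∨ j = σ.b) → constantCoeff (σ.ψ j) = 0) ∧
    InOffPlaneIdeal σ.a σ.b σ.δ.c (subst (shear σ.a σ.b σ.ψ) (σ.δ.f * ∏ l ∈ σ.δ.O, X l)) ∧ σ.δ.ApexLE2

/-- A valid loop state is a `SurfState`. -/
theorem Valid.surfState {σ : SurfDatum k m} (h : σ.Valid) : SurfState σ.δ :=
  ⟨⟨σ.a, σ.b, σ.ψ, h.2.1, h.2.2.1, h.2.2.2.1⟩, h.2.2.2.2⟩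

/-- The boundary letters OFF THE BASE. -/
def off (σ : SurfDatum k m) : Finset (Fin (m + 1)) := (σ.δ.E.erase σ.a).erase σ.b

omit [Field k] in
/-- Membership in the off-base boundary letters. -/
theorem mem_off_iff (σ : SurfDatum k m) (l : Fin (m + 1)) : l ∈ σ.off ↔ l ∈ σ.δ.E ∧ ¬ (l = σ.a ∨ l = σ.b) := by
  simp only [off, Finset.mem_erase, not_or]
  tauto

open Classical in
/-- THE PLANE SHADOW `x₀^{[a ∈ E]} · x₁^{[b ∈ E]} · ∏_{l off-base, ψ_l ≠ 0} ψ_l ∈ k⟦x₀,x₁⟧`: the boundary divisor restricted to the surface, in the base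
parameters. [OURS] -/
def shadow (σ : SurfDatum k m) : MvPowerSeries (Fin 2) k :=
  X 0 ^ (if σ.a ∈ σ.δ.E then 1 else 0) * X 1 ^ (if σ.b ∈ σ.δ.E then 1 else 0) * ∏ l ∈ σ.off with σ.ψ l ≠ 0, σ.ψ l

/-- THE SAME STATE WITH THE BASE LETTERS EXCHANGED (traces swapped: `ψ^{sw}(x₀,x₁) = ψ(x₁,x₀)`). -/
def swap (σ : SurfDatum k m) : SurfDatum k m :=
  ⟨σ.b₀, σ.δ, σ.b, σ.a, fun j => subst (![X 1, X 0] : Fin 2 → MvPowerSeries (Fin 2) k) (σ.ψ j)⟩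

/-- Components of the swapped state. -/
@[simp] theorem swap_b₀ (σ : SurfDatum k m) : σ.swap.b₀ = σ.b₀ := rfl
/-- Components of the swapped state. -/
@[simp] theorem swap_δ (σ : SurfDatum k m) : σ.swap.δ = σ.δ := rfl
/-- Components of the swapped state. -/
@[simp] theorem swap_a (σ : SurfDatum k m) : σ.swap.a = σ.b := rfl
/-- Components of the swapped state. -/
@[simp] theorem swap_bLetter (σ : SurfDatum k m) : σ.swap.b = σ.a := rfl
/-- Components of the swapped state. -/
@[simp] theorem swap_ψ (σ : SurfDatum k m) (j : Fin (m + 1)) :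
    σ.swap.ψ j = subst (![X 1, X 0] : Fin 2 → MvPowerSeries (Fin 2) k) (σ.ψ j) := rfl

/-- THE SUCCESSOR DATUM OF THE POINT MOVE at the answer `c`, READ AT THE SLOT `a`, with successor germ `s · G|_{y_a = 0}`: decoration = the transform,
base = (the exceptional letter `0`, the transported `b`), traces = part 6's `step₂` with the two variables exchanged (the exceptional parameter FIRST). [OURS] -/
def pointSucc (σ : SurfDatum k m) (c : Fin (m + 1) → k) (G : MvPowerSeries (Fin (m + 1 + 1)) k) : SurfDatum k m :=
  ⟨X 0 * TupleGame.slice σ.a G, σ.δ.transform (fun j => (X j : MvPowerSeries (Fin (m + 1)) k)) (fun _ => 1) c σ.a, 0,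
    Fin.predAbove σ.a σ.b.succ, fun j => subst (![X 1, X 0] : Fin 2 → MvPowerSeries (Fin 2) k) (step₂ σ.a σ.b σ.ψ c j)⟩

/-- Components of the point successor. -/
@[simp] theorem pointSucc_b₀ (σ : SurfDatum k m) (c : Fin (m + 1) → k) (G : MvPowerSeries (Fin (m + 1 + 1)) k) :
    (σ.pointSucc c G).b₀ = X 0 * TupleGame.slice σ.a G := rfl
/-- Components of the point successor. -/
@[simp] theorem pointSucc_δ (σ : SurfDatum k m) (c : Fin (m + 1) → k) (G : MvPowerSeries (Fin (m + 1 + 1)) k) :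
    (σ.pointSucc c G).δ = σ.δ.transform (fun j => (X j : MvPowerSeries (Fin (m + 1)) k)) (fun _ => 1) c σ.a := rfl
/-- Components of the point successor. -/
@[simp] theorem pointSucc_a (σ : SurfDatum k m) (c : Fin (m + 1) → k) (G : MvPowerSeries (Fin (m + 1 + 1)) k) :
    (σ.pointSucc c G).a = 0 := rfl
/-- Components of the point successor. -/
@[simp] theorem pointSucc_bLetter (σ : SurfDatum k m) (c : Fin (m + 1) → k) (G : MvPowerSeries (Fin (m + 1 + 1)) k) :
    (σ.pointSucc c G).b = Fin.predAbove σ.a σ.b.succ := rfl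
/-- Components of the point successor. -/
@[simp] theorem pointSucc_ψ (σ : SurfDatum k m) (c : Fin (m + 1) → k) (G : MvPowerSeries (Fin (m + 1 + 1)) k) (j : Fin (m + 1)) :
    (σ.pointSucc c G).ψ j = subst (![X 1, X 0] : Fin 2 → MvPowerSeries (Fin 2) k) (step₂ σ.a σ.b σ.ψ c j) := rfl

/-- The partial shear of the CURVE MOVE along `S ∩ {x_a = 0}` (boundary letters unsheared) and its weights `𝟙_{≠ b}`. -/
def curveΦ (σ : SurfDatum k m) : Fin (m + 1) → MvPowerSeries (Fin (m + 1)) k :=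
  shear σ.a σ.b (fun j => if j ∈ σ.δ.E then 0 else σ.ψ j)

/-- The weights `𝟙_{≠ b}` of the curve move along `S ∩ {x_a = 0}`. -/
def curveW (σ : SurfDatum k m) : Fin (m + 1) → ℕ := fun j => if j = σ.b then 0 else 1

/-- Unfolding of the curve move's coordinate change. -/
theorem curveΦ_eq (σ : SurfDatum k m) : σ.curveΦ = shear σ.a σ.b (fun j => if j ∈ σ.δ.E then 0 else σ.ψ j) := rfl

omit [Field k] in
/-- Unfolding of the curve move's weights. -/
theorem curveW_eq (σ : SurfDatum k m) : σ.curveW = fun j => if j = σ.b then 0 else 1 := rfl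

/-- THE SUCCESSOR DATUM OF THE CURVE MOVE along `S ∩ {x_a = 0}` at the answer `c` (its unique near point has live slot `a`), successor germ
`s · G|_{y_a = 0}`: base = (exceptional letter `0`, transported `b`), traces = part 11's `curveStep` with the variables exchanged. [OURS] -/
def curveSucc (σ : SurfDatum k m) (c : Fin (m + 1) → k) (G : MvPowerSeries (Fin (m + 1 + 1)) k) : SurfDatum k m :=
  ⟨X 0 * TupleGame.slice σ.a G, σ.δ.transform σ.curveΦ σ.curveW c σ.a, 0, Fin.predAbove σ.a σ.b.succ,
    fun j => subst (![X 1, X 0] : Fin 2 → MvPowerSeries (Fin 2) k) (curveStep σ.a σ.ψ σ.δ.E c j)⟩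

/-- Components of the curve successor. -/
@[simp] theorem curveSucc_b₀ (σ : SurfDatum k m) (c : Fin (m + 1) → k) (G : MvPowerSeries (Fin (m + 1 + 1)) k) :
    (σ.curveSucc c G).b₀ = X 0 * TupleGame.slice σ.a G := rfl
/-- Components of the curve successor. -/
@[simp] theorem curveSucc_δ (σ : SurfDatum k m) (c : Fin (m + 1) → k) (G : MvPowerSeries (Fin (m + 1 + 1)) k) :
    (σ.curveSucc c G).δ = σ.δ.transform σ.curveΦ σ.curveW c σ.a := rfl
/-- Components of the curve successor. -/
@[simp] theorem curveSucc_a (σ : SurfDatum k m) (c : Fin (m + 1) → k) (G : MvPowerSeries (Fin (m + 1 + 1)) k) :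
    (σ.curveSucc c G).a = 0 := rfl
/-- Components of the curve successor. -/
@[simp] theorem curveSucc_bLetter (σ : SurfDatum k m) (c : Fin (m + 1) → k) (G : MvPowerSeries (Fin (m + 1 + 1)) k) :
    (σ.curveSucc c G).b = Fin.predAbove σ.a σ.b.succ := rfl
/-- Components of the curve successor. -/
@[simp] theorem curveSucc_ψ (σ : SurfDatum k m) (c : Fin (m + 1) → k) (G : MvPowerSeries (Fin (m + 1 + 1)) k) (j : Fin (m + 1)) :
    (σ.curveSucc c G).ψ j = subst (![X 1, X 0] : Fin 2 → MvPowerSeries (Fin 2) k) (curveStep σ.a σ.ψ σ.δ.E c j) := rfl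

end SurfDatum

/-- THE BASE RE-COORDINATISATION by a two-variable substitution `Θ`: `x_a ↦ Θ₀(x_a, x_b)`, `x_b ↦ Θ₁(x_a, x_b)`, every other letter fixed. [OURS] -/
def baseChange (a b : Fin (m + 1)) (Θ : Fin 2 → MvPowerSeries (Fin 2) k) : Fin (m + 1) → MvPowerSeries (Fin (m + 1)) k :=
  fun j => if j = a then onPlane a b (Θ 0) else if j = b then onPlane a b (Θ 1) else X j

/-- Value at the first base letter. -/
theorem baseChange_left (a b : Fin (m + 1)) (Θ : Fin 2 → MvPowerSeries (Fin 2) k) : baseChange a b Θ a = onPlane a b (Θ 0) := if_pos rfl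

/-- Value at the second base letter. -/
theorem baseChange_right {a b : Fin (m + 1)} (hab : a ≠ b) (Θ : Fin 2 → MvPowerSeries (Fin 2) k) :
    baseChange a b Θ b = onPlane a b (Θ 1) := by
  rw [baseChange, if_neg (Ne.symm hab), if_pos rfl]

/-- Value off the base. -/
theorem baseChange_of_ne {a b j : Fin (m + 1)} (h : ¬ (j = a ∨ j = b)) (Θ : Fin 2 → MvPowerSeries (Fin 2) k) :
    baseChange a b Θ j = X j := by
  rw [baseChange, if_neg (fun h' => h (Or.inl h')), if_neg (fun h' => h (Or.inr h'))]

namespace SurfDatum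

/-- THE RE-COORDINATISED STATE: germ `b₀ ∘ R_Θ`, equation `f ∘ R_Θ` (same boundary and history), same base letters, traces `ψ_l ∘ Θ`. [OURS] -/
def twist (σ : SurfDatum k m) (Θ : Fin 2 → MvPowerSeries (Fin 2) k) : SurfDatum k m :=
  ⟨subst (baseChange σ.a σ.b Θ) σ.b₀, ⟨subst (baseChange σ.a σ.b Θ) σ.δ.f, σ.δ.E, σ.δ.O, σ.δ.O_subset⟩, σ.a, σ.b,
    fun j => subst Θ (σ.ψ j)⟩

/-- Components of the twisted state. -/
@[simp] theorem twist_b₀ (σ : SurfDatum k m) (Θ : Fin 2 → MvPowerSeries (Fin 2) k) :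
    (σ.twist Θ).b₀ = subst (baseChange σ.a σ.b Θ) σ.b₀ := rfl
/-- Components of the twisted state. -/
@[simp] theorem twist_δ_f (σ : SurfDatum k m) (Θ : Fin 2 → MvPowerSeries (Fin 2) k) :
    (σ.twist Θ).δ.f = subst (baseChange σ.a σ.b Θ) σ.δ.f := rfl
/-- Components of the twisted state. -/
@[simp] theorem twist_δ_E (σ : SurfDatum k m) (Θ : Fin 2 → MvPowerSeries (Fin 2) k) : (σ.twist Θ).δ.E = σ.δ.E := rfl
/-- Components of the twisted state. -/
@[simp] theorem twist_δ_O (σ : SurfDatum k m) (Θ : Fin 2 → MvPowerSeries (Fin 2) k) : (σ.twist Θ).δ.O = σ.δ.O := rfl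
/-- Components of the twisted state. -/
@[simp] theorem twist_a (σ : SurfDatum k m) (Θ : Fin 2 → MvPowerSeries (Fin 2) k) : (σ.twist Θ).a = σ.a := rfl
/-- Components of the twisted state. -/
@[simp] theorem twist_bLetter (σ : SurfDatum k m) (Θ : Fin 2 → MvPowerSeries (Fin 2) k) : (σ.twist Θ).b = σ.b := rfl
/-- Components of the twisted state. -/
@[simp] theorem twist_ψ (σ : SurfDatum k m) (Θ : Fin 2 → MvPowerSeries (Fin 2) k) (j : Fin (m + 1)) :
    (σ.twist Θ).ψ j = subst Θ (σ.ψ j) := rfl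

/-- MONOMIAL STATE with exponent table `e`: every boundary trace off the base is `0` or a UNIT times `x₀^{(e l).1} · x₁^{(e l).2}`. [OURS] -/
def IsMonomial (σ : SurfDatum k m) (e : Fin (m + 1) → ℕ × ℕ) : Prop :=
  ∀ l ∈ σ.off, σ.ψ l = 0 ∨ ∃ u : MvPowerSeries (Fin 2) k, constantCoeff u ≠ 0 ∧ σ.ψ l = u * X 0 ^ (e l).1 * X 1 ^ (e l).2

open Classical in
/-- The multiset of exponent pairs of the NON-ZERO boundary traces off the base (the endgame's measure carrier). [OURS] -/
def expMultiset (σ : SurfDatum k m) (e : Fin (m + 1) → ℕ × ℕ) : Multiset (ℕ × ℕ) :=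
  ((σ.off.filter fun l => σ.ψ l ≠ 0).val).map e

end SurfDatum

end GraphSurf

end TameFourTupleDrop

end Summit.ResolutionOfSingularities.ResolutionOfSingularities.Theorems

end
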